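import Mathlib.Topology.Sequences
import Mathlib.Topology.Bases
import Mathlib.Topology.MetricSpace.ProperSpace
import Literature.Analysis.FunctionSpaces.PointConfigVagueTopology
import Mathlib.Topology.UrysohnsLemma
import Mathlib.MeasureTheory.Constructions.BorelSpace.Basic
import Mathlib.MeasureTheory.Measure.Prokhorov
import Mathlib.MeasureTheory.Measure.LevyProkhorovMetric
import Literature.MathematicalPhysics.KineticTheory.RegularStationaryState
import Literature.MathematicalPhysics.KineticTheory.PointProcessVagueCompactness
import HarnessLib

/-!
# Kallenberg's Lemma 16.15 / Thm. 16.16 in the hard-core simple case: laws of hard-core configurations are vaguely compact — `HardCoreLawsVaguelyCompact` HOLDS (re-homed proofs)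

**Kallenberg 2002, Lemma 16.15 / Theorem 16.16 / Theorem A2.3 (ii) in the hard-core simple case — the named fact
`Literature.MathematicalPhysics.KineticTheory.PointProcess.HardCoreLawsVaguelyCompact` (`PointProcessVagueCompactness.lean`) HOLDS**: every
sequence of probability laws on the locally finite simple configurations of `ℝᵈ × ℝᵈ` carried by `δ`-hard-core configurations has a vague
cluster point (Laplace functionals converge along a subsequence for every `f ∈ C_c⁺`) which is again a probability law carried by `δ`-hard-core
configurations (O. Kallenberg, *Foundations of Modern Probability*, 2nd ed. 2002, Lemma 16.15, Thm. 16.16, Thm. A2.3 (ii) [Kallenberg2002]).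
ARCHITECTURE of the in-tree proof (kernel-checked, 0 cited facts; until now Summits-side only,
`Summits/AtomisticToContinuum/HydrodynamicLimit/Theorems/AntiMazurCoboundariesCorrectorPressureDecayTangentTightnessClosed.lean`): VAGUE LIMIT —
sequential vague compactness of uniformly separated configurations (`stub_vagueSeqCompactOfSeparated`: separated subsets of compacts are finite,
diagonal subsequences of eventually-approached points); COUNT BOREL — counts of open sets are measurable for the vague σ-algebra
(`stub_measurableOfVagueContinuous`); COMPACTNESS — a countable separating family of tents, the statistic `expStat : ω ↦ (e^{−Σ tent_n})_n ∈ [0,1]^ℕ`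
(continuous, injective, measurable; convergence of configurations from convergence of `expStat`), hard-core configurations are closed under
approach and have compact `expStat`-image, and Prokhorov / Lévy–Prokhorov on the compact image give the vague cluster point, again hard-core
(`stub_hardCoreLawsVaguelyCompact`).  RE-HOMED into `Literature/` by the Hodge foundations lane (`lit-hodgefound`, seat p20, generation 38): verbatim
DECLARATION-LEVEL ports of the 3 Summits modules `…/Theorems/AntiMazurCoboundariesCorrectorPressureDecayTangentTightness{VagueLimit (4), CountBorel (3),
Compactness (16)}.lean`, namespace `Summit.AtomisticToContinuum.HydrodynamicLimit.Theorems.KiferCompactification` re-rooted as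
`Literature.MathematicalPhysics.KineticTheory.PointProcess.HardCoreVagueCompactness` (in-tree `stub_…` names kept, they are proved theorems), followed
by the EXACT-name discharge `Literature.MathematicalPhysics.KineticTheory.PointProcess.HardCoreLawsVaguelyCompact_holds`.  Theorem-only file: no
definition, no new named fact (D-0026), no Summits import; built on the tree's Literature layer (`Analysis/FunctionSpaces/PointConfigVagueTopology`,
`MathematicalPhysics/KineticTheory/{RegularStationaryState, PointProcessVagueCompactness}`) and Mathlib (Prokhorov, Lévy–Prokhorov metric, Urysohn).
The Summits originals stay in place (transitional duplication).  WHAT THIS IS NOT: the hard-core SIMPLE case in `ℝᵈ × ℝᵈ` only (the fact's own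
TODO(general form)); nothing about random measures with multiplicities, and nothing about tangent tightness / the hydrodynamic-limit route.
-/

noncomputable section

/-!
## Part 1 — port of `Summits/AtomisticToContinuum/HydrodynamicLimit/Theorems/AntiMazurCoboundariesCorrectorPressureDecayTangentTightnessVagueLimit.lean` (4 declarations kept)

# Tangent tightness, compactness I: vague limits of separated configurations 

Helper file of the registered stub `stub_hardCoreLawsVaguelyCompact` (Kallenberg 2002, Lemma 16.15 +
Thm. 16.16 + Thm. A2.3 (ii), specialised to hard-core laws), namespace
`Summit.AtomisticToContinuum.HydrodynamicLimit.Theorems.KiferCompactification`.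

* `stub_vagueSeqCompactOfSeparated` (REGISTERED stub of this helper file): **sequential compactness of
  uniformly separated configurations in the vague topology.** In a proper metric space `X`, every sequence
  `ω_k` of `δ`-separated (`δ > 0`) locally finite configurations has a subsequence converging vaguely
  (`PointConfig.instTopologicalSpace`: `∑_{p ∈ ω_k} f p → ∑_{p ∈ ν} f p` for all `f ∈ C_c(X, ℝ)`) to a
  `δ`-separated configuration `ν`, every point of which is approached by points of the subsequence
  (Kallenberg 2002 Thm. A2.3 (ii) for simple point measures with a hard core; Baake–Lenz 2004 in the local
  rubber topology).

Proof: probe extraction along a dense sequence (compactness of `ℕ × ℚ → Bool`, as in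
`Literature/MathematicalPhysics/StatisticalMechanics/LocalMatchingCompactness.lean`, here for a general proper
metric space), the limit being the Kuratowski lower limit; vague convergence because, on the support of a
test function, eventually every particle sits alone in the `δ/2`-ball of a limit point and converges to it.

No new definitions. References: O. Kallenberg, *Foundations of Modern Probability* (2002), Thm. A2.3,
Lemma 16.15; M. Baake, D. Lenz, Ergodic Theory Dynam. Systems 24 (2004) §3.

(Verbatim declaration-level port — the declarations listed in the Part header count — of the Summits-side module of the
AtomisticToContinuum/HydrodynamicLimit tree (Kifer compactification, tangent tightness); route / stub / lead bookkeeping in the text above is historical.)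
-/

section Part1

open _root_.Set _root_.Filter _root_.Topology _root_.Function _root_.Metric

namespace Literature.MathematicalPhysics.KineticTheory.PointProcess.HardCoreVagueCompactness

open Literature.Analysis.FunctionSpaces (PointConfig)

variable {X : Type*} [MetricSpace X]

/-! ## Separated sets -/

/-- A `δ`-separated (`δ > 0`) subset of a compact set is finite (an infinite one would have an
accumulation point, near which two distinct points would be closer than `δ`).
[cite: Kallenberg2002, Lemma 16.15, Thm. 16.16 and Thm. A2.3 (ii)] -/
theorem finite_of_separated_of_subset_isCompact {S K : Set X} {δ : ℝ} (hδ : 0 < δ)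
    (hsep : ∀ p ∈ S, ∀ q ∈ S, p ≠ q → δ ≤ dist p q) (hK : IsCompact K) (hS : S ⊆ K) :
    S.Finite := by
  by_contra hinf
  obtain ⟨a, -, ha⟩ := Set.Infinite.exists_accPt_of_subset_isCompact hinf hK hS
  rw [accPt_iff_nhds] at ha
  obtain ⟨y₁, ⟨hy₁U, hy₁S⟩, hy₁a⟩ := ha (ball a (δ / 2)) (ball_mem_nhds a (half_pos hδ))
  have hr : 0 < dist y₁ a := dist_pos.2 hy₁a
  obtain ⟨y₂, ⟨hy₂U, hy₂S⟩, -⟩ := ha (ball a (dist y₁ a)) (ball_mem_nhds a hr)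
  rw [mem_ball] at hy₁U hy₂U
  have hne : y₁ ≠ y₂ := fun h => by
    rw [h] at hy₂U
    exact lt_irrefl _ hy₂U
  have h1 := hsep y₁ hy₁S y₂ hy₂S hne
  have : dist y₁ y₂ < δ :=
    calc dist y₁ y₂ ≤ dist y₁ a + dist y₂ a := dist_triangle_right _ _ _
      _ < δ / 2 + δ / 2 := add_lt_add hy₁U (hy₂U.trans hy₁U)
      _ = δ := by ring
  linarith

/-- The Kuratowski lower limit of a sequence of `δ`-separated sets is `δ`-separated.
[cite: Kallenberg2002, Lemma 16.15, Thm. 16.16 and Thm. A2.3 (ii)] -/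
theorem le_dist_of_eventually_approached {W : ℕ → Set X} {δ : ℝ}
    (hsep : ∀ k, ∀ p ∈ W k, ∀ q ∈ W k, p ≠ q → δ ≤ dist p q) {p q : X}
    (hp : ∀ ε : ℝ, 0 < ε → ∀ᶠ k in atTop, ∃ a ∈ W k, dist a p < ε)
    (hq : ∀ ε : ℝ, 0 < ε → ∀ᶠ k in atTop, ∃ a ∈ W k, dist a q < ε) (hpq : p ≠ q) :
    δ ≤ dist p q := by
  have hpq0 : 0 < dist p q := dist_pos.2 hpq
  refine le_of_forall_pos_lt_add fun η hη => ?_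
  set ε : ℝ := min (η / 4) (dist p q / 4) with hε
  have hε0 : 0 < ε := lt_min (by linarith) (by linarith)
  have hεη : ε ≤ η / 4 := min_le_left _ _
  have hεpq : ε ≤ dist p q / 4 := min_le_right _ _
  obtain ⟨k, ⟨a, ha, hap⟩, ⟨b, hb, hbq⟩⟩ := ((hp ε hε0).and (hq ε hε0)).exists
  by_cases hab : a = b
  · subst hab
    have : dist p q < 2 * ε :=
      calc dist p q ≤ dist a p + dist a q := dist_triangle_left _ _ _
        _ < ε + ε := add_lt_add hap hbq
        _ = 2 * ε := by ring
    linarith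
  · have h1 := hsep k a ha b hb hab
    have : dist a b < dist p q + 2 * ε :=
      calc dist a b ≤ dist a p + dist p b := dist_triangle _ _ _
        _ ≤ dist a p + (dist p q + dist b q) := add_le_add le_rfl (dist_triangle_right _ _ _)
        _ < ε + (dist p q + ε) := add_lt_add_of_lt_of_le hap (add_le_add le_rfl hbq.le)
        _ = dist p q + 2 * ε := by ring
    linarith

/-! ## Probe extraction -/

/-- **Probe extraction.** For every sequence of subsets of a proper metric space there is a subsequence
along which approach is stable: a point approached within every `ε` infinitely often is approached within
every `ε` eventually. (Record for each probe ball `B(u n, r)`, `u` a dense sequence, `r ∈ ℚ`, whether the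
set meets it, and extract a subsequence along which every probe is eventually constant, by compactness and
first countability of `ℕ × ℚ → Bool`.) [cite: Kallenberg2002, Lemma 16.15, Thm. 16.16 and Thm. A2.3 (ii)] -/
theorem exists_subseq_eventually_approached_of_frequently [ProperSpace X] [Nonempty X]
    (W : ℕ → Set X) :
    ∃ φ : ℕ → ℕ, StrictMono φ ∧ ∀ p : X,
      (∀ ε : ℝ, 0 < ε → ∃ᶠ k in atTop, ∃ q ∈ W (φ k), dist q p < ε) →
        ∀ ε : ℝ, 0 < ε → ∀ᶠ k in atTop, ∃ q ∈ W (φ k), dist q p < ε := by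
  classical
  obtain ⟨u, hu⟩ := TopologicalSpace.exists_dense_seq X
  let probe : ℕ → (ℕ × ℚ → Bool) := fun k nr =>
    decide (∃ q ∈ W k, dist q (u nr.1) < ((nr.2 : ℚ) : ℝ))
  obtain ⟨L, φ, hφ, hL⟩ := CompactSpace.tendsto_subseq probe
  have hKey0 : ∀ (n : ℕ) (r : ℚ), (∃ᶠ k in atTop, ∃ q ∈ W (φ k), dist q (u n) < (r : ℝ)) →
      ∀ᶠ k in atTop, ∃ q ∈ W (φ k), dist q (u n) < (r : ℝ) := by
    intro n r hfr
    have ht : Tendsto (fun k => probe (φ k) (n, r)) atTop (𝓝 (L (n, r))) :=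
      tendsto_pi_nhds.1 hL (n, r)
    rw [nhds_discrete Bool, tendsto_pure] at ht
    cases hLnr : L (n, r) with
    | true =>
      filter_upwards [ht] with k hk
      rw [hLnr] at hk
      simpa [probe] using hk
    | false =>
      exfalso
      obtain ⟨k, hk1, hk2⟩ := (hfr.and_eventually ht).exists
      rw [hLnr] at hk2
      simp only [probe, decide_eq_false_iff_not] at hk2
      exact hk2 hk1
  refine ⟨φ, hφ, fun p hp ε hε => ?_⟩
  obtain ⟨r, hr0, hrε⟩ := exists_rat_btwn (half_pos hε)
  have hr0' : (0 : ℝ) < r := by exact_mod_cast hr0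
  obtain ⟨n, hn⟩ := hu.exists_dist_lt p (half_pos hr0')
  have hfr : ∃ᶠ k in atTop, ∃ q ∈ W (φ k), dist q (u n) < (r : ℝ) := by
    refine (hp (r / 2) (half_pos hr0')).mono fun k ⟨q, hq, hqp⟩ => ⟨q, hq, ?_⟩
    calc dist q (u n) ≤ dist q p + dist p (u n) := dist_triangle _ _ _
      _ < r / 2 + r / 2 := add_lt_add hqp hn
      _ = r := by ring
  filter_upwards [hKey0 n r hfr] with k ⟨q, hq, hqn⟩
  refine ⟨q, hq, ?_⟩
  calc dist q p ≤ dist q (u n) + dist p (u n) := dist_triangle_right _ _ _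
    _ < r + r / 2 := add_lt_add hqn hn
    _ < ε := by linarith

/-! ## Sequential compactness of separated configurations in the vague topology -/

/-- **Sequential vague compactness of uniformly separated configurations** (Kallenberg 2002, Thm. A2.3 (ii)
for simple point measures with a hard core). Let `X` be a proper metric space, `δ > 0`, and `ω_k` locally
finite configurations each of which is `δ`-separated. Then along some subsequence `φ`, `ω_(φ k)` converges in
the vague topology of `PointConfig X` to a `δ`-separated configuration `ν`, and every point of `ν` is, for
every `ε > 0`, eventually within `ε` of a point of `ω_(φ k)`. Registered helper stub of line `FirstLemma`.
[cite: Kallenberg2002, Lemma 16.15, Thm. 16.16 and Thm. A2.3 (ii)] -/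
theorem stub_vagueSeqCompactOfSeparated {X : Type*} [MetricSpace X] [ProperSpace X] {δ : ℝ}
    (hδ : 0 < δ) (ω : ℕ → PointConfig X)
    (hsep : ∀ k, ∀ p ∈ ω k, ∀ q ∈ ω k, p ≠ q → δ ≤ dist p q) :
    ∃ (φ : ℕ → ℕ) (ν : PointConfig X), StrictMono φ ∧
      (∀ p ∈ ν, ∀ q ∈ ν, p ≠ q → δ ≤ dist p q) ∧
      (∀ p ∈ ν, ∀ ε : ℝ, 0 < ε → ∀ᶠ k in atTop, ∃ q ∈ ω (φ k), dist q p < ε) ∧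
      Tendsto (fun k => ω (φ k)) atTop (𝓝 ν) := by
  classical
  rcases isEmpty_or_nonempty X with hX | hX
  · have hall : ∀ k, ω k = ∅ := fun k => PointConfig.ext fun p => isEmptyElim p
    refine ⟨id, ∅, strictMono_id, fun p => isEmptyElim p, fun p => isEmptyElim p, ?_⟩
    simp only [hall, id]
    exact tendsto_const_nhds
  obtain ⟨φ, hφ, hKey⟩ := exists_subseq_eventually_approached_of_frequently (fun k => (ω k : Set X))
  -- the subsequence and its Kuratowski lower limit
  set W : ℕ → Set X := fun k => (ω (φ k) : Set X) with hW
  have hsepW : ∀ k, ∀ p ∈ W k, ∀ q ∈ W k, p ≠ q → δ ≤ dist p q := fun k => hsep (φ k)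
  set L : Set X := {p | ∀ ε : ℝ, 0 < ε → ∀ᶠ k in atTop, ∃ a ∈ W k, dist a p < ε} with hL
  have hLsep : ∀ p ∈ L, ∀ q ∈ L, p ≠ q → δ ≤ dist p q :=
    fun p hp q hq hpq => le_dist_of_eventually_approached hsepW hp hq hpq
  have hLfin : ∀ K : Set X, IsCompact K → (L ∩ K).Finite := fun K hK =>
    finite_of_separated_of_subset_isCompact hδ (fun p hp q hq hpq => hLsep p hp.1 q hq.1 hpq) hK
      inter_subset_right
  let ν : PointConfig X := ⟨L, hLfin⟩
  have hνL : (ν : Set X) = L := rfl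
  -- (A) a limit point is eventually matched by exactly one particle in its `δ/2`-ball, converging to it
  set q : X → ℕ → X := fun x k =>
    if h : (W k ∩ ball x (δ / 2)).Nonempty then h.some else x with hq
  have hA : ∀ x ∈ L, (∀ᶠ k in atTop, W k ∩ ball x (δ / 2) = {q x k}) ∧
      Tendsto (q x) atTop (𝓝 x) := by
    intro x hx
    have huniq : ∀ k, (W k ∩ ball x (δ / 2)).Nonempty → W k ∩ ball x (δ / 2) = {q x k} := by
      intro k hk
      have hqk : q x k = hk.some := by rw [hq]; exact dif_pos hk
      have hmem : q x k ∈ W k ∩ ball x (δ / 2) := hqk ▸ hk.some_mem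
      refine Set.eq_singleton_iff_unique_mem.2 ⟨hmem, fun a ha => ?_⟩
      by_contra hne
      have h1 := hsepW k a ha.1 (q x k) hmem.1 hne
      have h2 : dist a (q x k) < δ :=
        calc dist a (q x k) ≤ dist a x + dist (q x k) x := dist_triangle_right _ _ _
          _ < δ / 2 + δ / 2 := add_lt_add (mem_ball.1 ha.2) (mem_ball.1 hmem.2)
          _ = δ := by ring
      linarith
    refine ⟨?_, ?_⟩
    · filter_upwards [hx (δ / 2) (half_pos hδ)] with k ⟨a, ha, hax⟩
      exact huniq k ⟨a, ha, mem_ball.2 hax⟩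
    · rw [Metric.tendsto_atTop']
      intro ε hε
      have hε' : 0 < min ε (δ / 2) := lt_min hε (half_pos hδ)
      obtain ⟨N, hN⟩ := eventually_atTop.1 (hx _ hε')
      refine ⟨N, fun k hk => ?_⟩
      obtain ⟨a, ha, hax⟩ := hN k hk.le
      have hax' : a ∈ W k ∩ ball x (δ / 2) := ⟨ha, mem_ball.2 (hax.trans_le (min_le_right _ _))⟩
      have heq := huniq k ⟨a, hax'⟩
      rw [heq, mem_singleton_iff] at hax'
      rw [← hax']
      exact hax.trans_le (min_le_left _ _)
  refine ⟨φ, ν, hφ, hLsep, fun p hp => hp, ?_⟩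
  rw [PointConfig.tendsto_nhds_iff]
  intro f
  set K : Set X := tsupport (f : X → ℝ) with hKdef
  have hK : IsCompact K := f.hasCompactSupport
  have hFfin : (L ∩ K).Finite := hLfin K hK
  -- (B) eventually, every particle in the support sits in the `δ/2`-ball of a limit point of `K`
  have hB : ∀ᶠ k in atTop, W k ∩ K ⊆ ⋃ x ∈ L ∩ K, ball x (δ / 2) := by
    by_contra hcon
    obtain ⟨ψ, hψ, hψP⟩ := extraction_of_frequently_atTop (not_eventually.1 hcon)
    have hex : ∀ l, ∃ a, a ∈ W (ψ l) ∩ K ∧ a ∉ ⋃ x ∈ L ∩ K, ball x (δ / 2) := fun l =>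
      not_subset.1 (hψP l)
    choose a haWK hfar using hex
    obtain ⟨b, hbK, θ, hθ, hlim⟩ := hK.tendsto_subseq (x := a) fun l => (haWK l).2
    have hbL : b ∈ L := by
      refine hKey b fun ε' hε' => ?_
      have hi : ∀ᶠ i in atTop, dist (a (θ i)) b < ε' := Metric.tendsto_nhds.1 hlim ε' hε'
      refine frequently_atTop.2 fun N => ?_
      obtain ⟨i, hi', hiN⟩ := (hi.and (eventually_ge_atTop N)).exists
      exact ⟨ψ (θ i), hiN.trans (hθ.le_apply.trans hψ.le_apply), a (θ i), (haWK (θ i)).1, hi'⟩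
    obtain ⟨i, hi⟩ := (Metric.tendsto_nhds.1 hlim (δ / 2) (half_pos hδ)).exists
    exact hfar (θ i) (mem_biUnion (show b ∈ L ∩ K from ⟨hbL, hbK⟩) (mem_ball.2 hi))
  have hE : ∀ᶠ k in atTop, ∀ x ∈ L ∩ K, W k ∩ ball x (δ / 2) = {q x k} :=
    hFfin.eventually_all.2 fun x hx => (hA x hx.1).1
  -- the limit statistic is a finite sum over `L ∩ K`
  have hν : ν.sumFn f = ∑ x ∈ hFfin.toFinset, f x := by
    rw [PointConfig.sumFn_def, hνL]
    refine finsum_mem_eq_sum_of_subset _ (fun p hp => ?_) ?_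
    · rw [Finite.coe_toFinset]
      exact ⟨hp.1, subset_tsupport _ hp.2⟩
    · rw [Finite.coe_toFinset]
      exact inter_subset_left
  have hlim : Tendsto (fun k => ∑ x ∈ hFfin.toFinset, f (q x k)) atTop
      (𝓝 (∑ x ∈ hFfin.toFinset, f x)) :=
    tendsto_finsetSum _ fun x hx =>
      (f.continuous.tendsto x).comp (hA x (hFfin.mem_toFinset.1 hx).1).2
  rw [hν]
  refine hlim.congr' ?_
  filter_upwards [hB, hE] with k hkB hkE
  -- the `k`-th statistic, split over the disjoint balls
  have hdisj : (L ∩ K).PairwiseDisjoint fun x => W k ∩ ball x (δ / 2) := by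
    intro x hx y hy hxy
    refine disjoint_left.2 fun p hpx hpy => ?_
    have h1 := hLsep x hx.1 y hy.1 hxy
    have h2 : dist x y < δ :=
      calc dist x y ≤ dist p x + dist p y := dist_triangle_left _ _ _
        _ < δ / 2 + δ / 2 := add_lt_add (mem_ball.1 hpx.2) (mem_ball.1 hpy.2)
        _ = δ := by ring
    linarith
  have hsplit : (ω (φ k)).sumFn f = ∑ᶠ p ∈ ⋃ x ∈ L ∩ K, (W k ∩ ball x (δ / 2)), f p := by
    rw [PointConfig.sumFn_def]
    refine finsum_mem_inter_support_eq _ _ _ (Set.ext fun p => ⟨fun hp => ?_, fun hp => ?_⟩)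
    · have hpK : p ∈ K := subset_tsupport _ hp.2
      obtain ⟨x, hx, hpx⟩ := mem_iUnion₂.1 (hkB ⟨hp.1, hpK⟩)
      exact ⟨mem_biUnion hx ⟨hp.1, hpx⟩, hp.2⟩
    · obtain ⟨x, -, hpx⟩ := mem_iUnion₂.1 hp.1
      exact ⟨hpx.1, hp.2⟩
  rw [hsplit, finsum_mem_biUnion hdisj hFfin fun x hx => ?_, finsum_mem_eq_finite_toFinset_sum _ hFfin]
  · refine Finset.sum_congr rfl fun x hx => ?_
    rw [hkE x (hFfin.mem_toFinset.1 hx), finsum_mem_singleton]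
  · rw [hkE x hx]
    exact finite_singleton _

end Literature.MathematicalPhysics.KineticTheory.PointProcess.HardCoreVagueCompactness

end Part1

/-!
## Part 2 — port of `Summits/AtomisticToContinuum/HydrodynamicLimit/Theorems/AntiMazurCoboundariesCorrectorPressureDecayTangentTightnessCountBorel.lean` (3 declarations kept)

# Tangent tightness, compactness II: vaguely continuous maps are count-measurable 

Helper file of the registered stub `stub_hardCoreLawsVaguelyCompact` (Kallenberg 2002, Lemma 16.15 +
Thm. 16.16 + Thm. A2.3 (ii), specialised to hard-core laws), namespace
`Summit.AtomisticToContinuum.HydrodynamicLimit.Theorems.KiferCompactification`.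

One half of Kallenberg's Thm. A2.3 (iv) ("the Borel σ-algebra of the vague topology is the count
σ-algebra") in the form needed to push laws back to configurations:

* `isOpen_setOf_natCast_le_count`: for `U ⊆ X` open, `{ω | n ≤ N_ω(U)}` is OPEN in the vague topology of
  `PointConfig X` (lower semicontinuity of counts of open sets: `n` points in `U` carry a `[0,1]`-valued
  bump `g ∈ C_c(U)` with `∑_{p ∈ ω} g p ≥ n`, Urysohn);
* `measurable_count_comp_of_isOpen`, `stub_measurableOfVagueContinuous` (REGISTERED stub of this helper
  file): a vaguely continuous map `S : α → PointConfig X` from a topological space with a σ-algebra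
  containing the open sets is measurable for the COUNT σ-algebra (Dynkin-system argument over the
  π-system of open sets, on the relatively compact windows `B(x₀, n + 1)`, using the counting measures
  `PointConfig.toMeasure`).

No new definitions. References: O. Kallenberg, *Foundations of Modern Probability* (2002), Thm. A2.3;
D. J. Daley, D. Vere-Jones, *An Introduction to the Theory of Point Processes* II (2008), Thm. 9.1.IV.

(Verbatim declaration-level port — the declarations listed in the Part header count — of the Summits-side module of the
AtomisticToContinuum/HydrodynamicLimit tree (Kifer compactification, tangent tightness); route / stub / lead bookkeeping in the text above is historical.)
-/

section Part2

open _root_.MeasureTheory _root_.Set _root_.Filter _root_.Topology _root_.Function _root_.Metric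
open scoped _root_.ENNReal

namespace Literature.MathematicalPhysics.KineticTheory.PointProcess.HardCoreVagueCompactness

open Literature.Analysis.FunctionSpaces (PointConfig)

variable {X : Type*} [MetricSpace X] [ProperSpace X]

/-! ## Counts of open sets are vaguely lower semicontinuous -/

/-- **Counts of open sets are vaguely lower semicontinuous**: for `U` open and `n : ℕ`, the event
`{ω | n ≤ N_ω(U)}` is open in the vague topology (choose `n` points of `ω` in `U` and a bump `g ∈ C_c`,
`0 ≤ g ≤ 1`, `g = 1` at these points, `g = 0` off `U`: then `∑_{p ∈ ω'} g p > n - 1` is a vague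
neighbourhood of `ω` on which `N(U) ≥ n`). [cite: Kallenberg2002, Lemma 16.15, Thm. 16.16 and Thm. A2.3 (ii)] -/
theorem isOpen_setOf_natCast_le_count {U : Set X} (hU : IsOpen U) (n : ℕ) :
    IsOpen {ω : PointConfig X | (n : ℕ∞) ≤ ω.count U} := by
  refine isOpen_iff_forall_mem_open.2 fun ω hω => ?_
  obtain ⟨t, htsub, htcard⟩ := Set.exists_subset_encard_eq (s := (ω : Set X) ∩ U) hω
  have htfin : t.Finite := Set.finite_of_encard_eq_coe htcard
  have htU : t ⊆ U := htsub.trans inter_subset_right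
  obtain ⟨g, hgt, hgU, hgc, hg01⟩ := exists_continuous_one_zero_of_isCompact htfin.isCompact
    hU.isClosed_compl (disjoint_compl_right_iff_subset.2 htU)
  have hsuppU : support (g : X → ℝ) ⊆ U := fun x hx => by
    by_contra hxU
    exact hx (hgU hxU)
  refine ⟨{ω' | (n : ℝ) - 1 < ω'.sumFn g}, fun ω' hω' => ?_,
    isOpen_lt continuous_const (PointConfig.continuous_sumFn' g.continuous hgc), ?_⟩
  · -- from the statistic to the count
    have hfin' := ω'.finite_inter_support hgc
    have hle : ω'.sumFn g ≤ hfin'.toFinset.card := by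
      rw [ω'.sumFn_eq_sum hgc]
      calc ∑ p ∈ hfin'.toFinset, g p ≤ ∑ p ∈ hfin'.toFinset, (1 : ℝ) :=
            Finset.sum_le_sum fun p _ => (hg01 p).2
        _ = hfin'.toFinset.card := by rw [Finset.sum_const, nsmul_eq_mul, mul_one]
    have hn : n ≤ hfin'.toFinset.card := by
      have h1 : (n : ℝ) - 1 < hfin'.toFinset.card := lt_of_lt_of_le hω' hle
      have h2 : (n : ℝ) < (hfin'.toFinset.card : ℝ) + 1 := by linarith
      exact Nat.lt_add_one_iff.1 (by exact_mod_cast h2)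
    show (n : ℕ∞) ≤ ω'.count U
    calc (n : ℕ∞) ≤ (hfin'.toFinset.card : ℕ∞) := by exact_mod_cast hn
      _ = ((ω' : Set X) ∩ support (g : X → ℝ)).encard := hfin'.encard_eq_coe_toFinset_card.symm
      _ ≤ ω'.count U := Set.encard_le_encard (inter_subset_inter_right _ hsuppU)
  · -- `ω` lies in the neighbourhood
    show (n : ℝ) - 1 < ω.sumFn g
    have hfin := ω.finite_inter_support hgc
    have hsub : htfin.toFinset ⊆ hfin.toFinset := by
      rw [Finite.toFinset_subset_toFinset]
      intro p hp
      refine ⟨(htsub hp).1, ?_⟩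
      rw [mem_support, (hgt hp : g p = 1)]
      exact one_ne_zero
    have hcard : (htfin.toFinset.card : ℝ) = n := by
      have h := htfin.encard_eq_coe_toFinset_card
      rw [htcard] at h
      exact_mod_cast (ENat.coe_inj.1 h).symm
    have hge : (n : ℝ) ≤ ω.sumFn g := by
      rw [ω.sumFn_eq_sum hgc, ← hcard]
      calc (htfin.toFinset.card : ℝ) = ∑ p ∈ htfin.toFinset, g p := by
            rw [Finset.sum_eq_card_nsmul (b := (1 : ℝ)) fun p hp => ?_, nsmul_eq_mul, mul_one]
            exact hgt (htfin.mem_toFinset.1 hp)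
        _ ≤ ∑ p ∈ hfin.toFinset, g p :=
            Finset.sum_le_sum_of_subset_of_nonneg hsub fun p _ _ => (hg01 p).1
    linarith

/-! ## Vaguely continuous maps are count-measurable -/

section Measurable

variable {α : Type*} [TopologicalSpace α] [MeasurableSpace α] [OpensMeasurableSpace α]

/-- Counts of open sets along a vaguely continuous map are measurable (`{n ≤ N(U)}` pulls back to an
open set, and `{N(U) = n} = {n ≤ N(U)} \ {n + 1 ≤ N(U)}`).
[cite: Kallenberg2002, Lemma 16.15, Thm. 16.16 and Thm. A2.3 (ii)] -/
theorem measurable_count_comp_of_isOpen {S : α → PointConfig X} (hS : Continuous S) {U : Set X}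
    (hU : IsOpen U) : Measurable fun a => (S a).count U := by
  refine ENat.measurable_iff.2 fun n => ?_
  have hO : ∀ m : ℕ, IsOpen {a | (m : ℕ∞) ≤ (S a).count U} := fun m =>
    (isOpen_setOf_natCast_le_count hU m).preimage hS
  have hrepr : (fun a => (S a).count U) ⁻¹' {(n : ℕ∞)} =
      {a | (n : ℕ∞) ≤ (S a).count U} \ {a | ((n + 1 : ℕ) : ℕ∞) ≤ (S a).count U} := by
    ext a
    simp only [mem_preimage, mem_singleton_iff, Set.mem_sdiff, mem_setOf_eq, not_le, Nat.cast_add,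
      Nat.cast_one]
    constructor
    · intro h
      rw [h]
      exact ⟨le_rfl, (ENat.lt_add_one_iff (ENat.coe_ne_top n)).2 le_rfl⟩
    · rintro ⟨h1, h2⟩
      exact le_antisymm ((ENat.lt_add_one_iff (ENat.coe_ne_top n)).1 h2) h1
  rw [hrepr]
  exact (hO n).measurableSet.diff (hO (n + 1)).measurableSet

/-- **Vaguely continuous maps are count-measurable** (one half of Kallenberg's Thm. A2.3 (iv): the count
σ-algebra is contained in the Borel σ-algebra of the vague topology, along any continuous map). For a proper
metric space `X` and a topological space `α` whose σ-algebra contains the open sets, every continuous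
`S : α → PointConfig X` (vague topology) is measurable for the count σ-algebra: by a Dynkin-system argument
over the π-system of open sets of `X`, inside the relatively compact windows `B(x₀, n + 1)`, the counting
measures `a ↦ (S a).toMeasure (s ∩ B(x₀, n + 1))` are measurable for all Borel `s`, and `N(s)` is their
supremum over `n`. Registered helper stub of line `FirstLemma`.
[cite: Kallenberg2002, Lemma 16.15, Thm. 16.16 and Thm. A2.3 (ii)] -/
theorem stub_measurableOfVagueContinuous {X : Type*} [MetricSpace X] [ProperSpace X]
    [MeasurableSpace X] [BorelSpace X] {α : Type*} [TopologicalSpace α] [MeasurableSpace α]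
    [OpensMeasurableSpace α] {S : α → PointConfig X} (hS : Continuous S) : Measurable S := by
  rcases isEmpty_or_nonempty X with hX | ⟨⟨x₀⟩⟩
  · refine PointConfig.measurable_of_count fun s _ => ?_
    have h0 : ∀ a, (S a).count s = 0 := fun a => by
      rw [PointConfig.count, Set.eq_empty_of_isEmpty (_ ∩ s), Set.encard_empty]
    simp only [h0]
    exact measurable_const
  -- the windows
  set B : ℕ → Set X := fun n => ball x₀ ((n : ℝ) + 1) with hB
  have hBopen : ∀ n, IsOpen (B n) := fun n => isOpen_ball
  have hBfin : ∀ (ω : PointConfig X) (n : ℕ), ((ω : Set X) ∩ B n).Finite := fun ω n =>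
    (ω.finite_inter_isCompact _ (isCompact_closedBall x₀ ((n : ℝ) + 1))).subset
      (inter_subset_inter_right _ ball_subset_closedBall)
  have htop : ∀ (ω : PointConfig X) (n : ℕ) {s : Set X}, MeasurableSet s →
      ω.toMeasure (s ∩ B n) ≠ ∞ := by
    intro ω n s hs
    rw [PointConfig.toMeasure_apply _ (hs.inter (hBopen n).measurableSet)]
    have hlt : ω.count (s ∩ B n) < ⊤ :=
      lt_of_le_of_lt (ω.count_mono inter_subset_right) (hBfin ω n).encard_lt_top
    exact ENat.toENNReal_ne_top.2 hlt.ne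
  -- open sets
  have hopen : ∀ {t : Set X}, IsOpen t → ∀ n, Measurable fun a => (S a).toMeasure (t ∩ B n) := by
    intro t ht n
    have hmeas : MeasurableSet (t ∩ B n) := (ht.inter (hBopen n)).measurableSet
    simp only [PointConfig.toMeasure_apply _ hmeas]
    exact measurable_from_top.comp (measurable_count_comp_of_isOpen hS (ht.inter (hBopen n)))
  -- Dynkin induction over the π-system of open sets
  have hind : ∀ s, MeasurableSet s → ∀ n, Measurable fun a => (S a).toMeasure (s ∩ B n) := by
    intro s hs
    induction s, hs using MeasurableSet.induction_on_open with
    | isOpen t ht => exact hopen ht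
    | compl t htm ih =>
      intro n
      have h_eq : ∀ a, (S a).toMeasure (tᶜ ∩ B n) =
          (S a).toMeasure (univ ∩ B n) - (S a).toMeasure (t ∩ B n) := by
        intro a
        rw [univ_inter, ← measure_sdiff inter_subset_right
          (htm.inter (hBopen n).measurableSet).nullMeasurableSet (htop _ n htm)]
        congr 1
        ext x
        simp only [mem_inter_iff, mem_compl_iff, Set.mem_sdiff]
        tauto
      simp only [h_eq]
      exact (hopen isOpen_univ n).sub (ih n)
    | iUnion f hdisj hfm ih =>
      intro n
      have h_eq : ∀ a, (S a).toMeasure ((⋃ i, f i) ∩ B n) = ∑' i, (S a).toMeasure (f i ∩ B n) := by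
        intro a
        rw [iUnion_inter]
        exact measure_iUnion (fun i j hij => (hdisj hij).mono inter_subset_left inter_subset_left)
          fun i => (hfm i).inter (hBopen n).measurableSet
      simp only [h_eq, ENNReal.tsum_eq_iSup_sum]
      exact Measurable.iSup fun t => Finset.measurable_fun_sum t fun i _ => ih i n
  -- conclusion: `N(s) = sup_n N(s ∩ B n)`
  refine PointConfig.measurable_of_count fun s hs => ?_
  have hmono : Monotone fun n => s ∩ B n := fun m k hmk =>
    inter_subset_inter_right _ (ball_subset_ball (by simpa using (Nat.cast_le.2 hmk : (m : ℝ) ≤ k)))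
  have hcoe : Measurable fun a => (S a).toMeasure s := by
    have h_eq : ∀ a, (S a).toMeasure s = ⨆ n, (S a).toMeasure (s ∩ B n) := by
      intro a
      rw [← hmono.measure_iUnion, ← inter_iUnion]
      simp only [hB, iUnion_ball_nat_succ, inter_univ]
    simp only [h_eq]
    exact Measurable.iSup fun n => hind s hs n
  refine ENat.measurable_iff.2 fun n => ?_
  have hrepr : (fun a => (S a).count s) ⁻¹' {(n : ℕ∞)} =
      (fun a => (S a).toMeasure s) ⁻¹' {((n : ℕ∞) : ℝ≥0∞)} := by
    ext a
    simp only [mem_preimage, mem_singleton_iff, PointConfig.toMeasure_apply _ hs, ENat.toENNReal_inj]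
  rw [hrepr]
  exact hcoe (measurableSet_singleton _)

end Measurable

end Literature.MathematicalPhysics.KineticTheory.PointProcess.HardCoreVagueCompactness

end Part2

/-!
## Part 3 — port of `Summits/AtomisticToContinuum/HydrodynamicLimit/Theorems/AntiMazurCoboundariesCorrectorPressureDecayTangentTightnessCompactness.lean` (16 declarations kept)

# Tangent tightness, compactness III: hard-core laws are vaguely relatively compact 

Discharge of the registered stub `stub_hardCoreLawsVaguelyCompact` — the body of the named fact
`HardCoreLawsVaguelyCompact` (Kallenberg 2002, Lemma 16.15 + Thm. 16.16 + Thm. A2.3 (ii), specialised to laws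
of `δ`-hard-core simple configurations in `ℝᵈ × ℝᵈ`): every sequence of probability laws of `δ`-hard-core
configurations has a `δ`-hard-core probability vague cluster point
(`PointProcess.IsVagueClusterPoint`: Laplace functionals converge along a subsequence for every continuous
compactly supported `f ≥ 0`). Namespace `Summit.AtomisticToContinuum.HydrodynamicLimit.Theorems.KiferCompactification`.

## Proof (embedding by exponential statistics of a separating family)

* `exists_separating_family`: on a proper metric space there is a countable family `g n ∈ C_c⁺` whose linear
  statistics `∑_{p ∈ ω} g n p` SEPARATE locally finite configurations (tents
  `x ↦ max 0 (1 - dist x (u i) · (m + 1))` about a dense sequence `u`: a point `p ∈ ω ∖ ω'` is isolated in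
  `ω ∪ ω'` and a small tent about a centre near `p` sees `p` in `ω` and nothing in `ω'`);
* the map `F ω = (exp (-∑_{p ∈ ω} g n p))ₙ : PointConfig X → (ℕ → [0, 1])` is vaguely continuous,
  count-measurable (`measurable_exp_neg_finsum`) and injective; on `δ`-separated configurations, convergence
  of `F` is vague convergence (`tendsto_of_tendsto_expStat`, sub-subsequence argument with
  `stub_vagueSeqCompactOfSeparated`);
* the image `Z = F(K_δ)` of the hard-core configurations is closed (`isClosed_image_expStat`, again by
  sequential compactness; vague limits of hard-core configurations are hard core, `isHardCore_of_approached`)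
  inside the compact cube, hence a compact metrisable space; the inverse `S : Z → K_δ` is vaguely continuous,
  hence count-measurable (`stub_measurableOfVagueContinuous`);
* push the laws to `Z` (Mathlib: `ProbabilityMeasure Z` is compact and, by Lévy–Prokhorov, metrisable),
  extract a convergent subsequence, pull the limit back by `S`; Laplace functionals of `C_c⁺` test functions
  are expectations of bounded continuous functions on `Z`.

No new definitions. References: O. Kallenberg, *Foundations of Modern Probability* (2002), Lemma 16.15,
Thm. 16.16, Thm. A2.3.

(Verbatim declaration-level port — the declarations listed in the Part header count — of the Summits-side module of the
AtomisticToContinuum/HydrodynamicLimit tree (Kifer compactification, tangent tightness); route / stub / lead bookkeeping in the text above is historical.)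
-/

section Part3

open _root_.MeasureTheory _root_.Set _root_.Filter _root_.Topology _root_.Function _root_.Metric
open scoped _root_.ENNReal BoundedContinuousFunction

namespace Literature.MathematicalPhysics.KineticTheory.PointProcess.HardCoreVagueCompactness

open Literature.Analysis.FunctionSpaces (PointConfig)
open Literature.Analysis.FluidPDE (IsHardCore isHardCore_empty)
open Literature.MathematicalPhysics.KineticTheory.PointProcess (laplaceFunctional measurable_exp_neg_finsum)

/-! ## Tents -/

section Tent

variable {X : Type*} [MetricSpace X]

/-- The tent `x ↦ max 0 (1 - dist x u / r)` is continuous.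
[cite: Kallenberg2002, Lemma 16.15, Thm. 16.16 and Thm. A2.3 (ii)] -/
theorem continuous_tent (u : X) (r : ℝ) : Continuous fun x => max 0 (1 - dist x u / r) :=
  continuous_const.max (continuous_const.sub ((continuous_id.dist continuous_const).div_const r))

/-- The tent is positive on the open ball. [cite: Kallenberg2002, Lemma 16.15, Thm. 16.16 and Thm. A2.3 (ii)] -/
theorem tent_pos {u : X} {r : ℝ} (hr : 0 < r) {x : X} (hx : dist x u < r) :
    0 < max 0 (1 - dist x u / r) :=
  lt_max_of_lt_right (by rwa [sub_pos, div_lt_one hr])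

/-- The tent vanishes off the open ball. [cite: Kallenberg2002, Lemma 16.15, Thm. 16.16 and Thm. A2.3 (ii)] -/
theorem tent_eq_zero {u : X} {r : ℝ} (hr : 0 < r) {x : X} (hx : r ≤ dist x u) :
    max 0 (1 - dist x u / r) = 0 :=
  max_eq_left (by rwa [sub_nonpos, one_le_div hr])

/-- The support of the tent is contained in the open ball.
[cite: Kallenberg2002, Lemma 16.15, Thm. 16.16 and Thm. A2.3 (ii)] -/
theorem support_tent_subset {u : X} {r : ℝ} (hr : 0 < r) :
    (support fun x => max 0 (1 - dist x u / r)) ⊆ ball u r :=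
  fun x hx => by
    rw [mem_ball]
    by_contra h
    exact hx (tent_eq_zero hr (not_lt.1 h))

/-- On a proper space tents of positive radius have compact support.
[cite: Kallenberg2002, Lemma 16.15, Thm. 16.16 and Thm. A2.3 (ii)] -/
theorem hasCompactSupport_tent [ProperSpace X] (u : X) {r : ℝ} (hr : 0 < r) :
    HasCompactSupport fun x => max 0 (1 - dist x u / r) :=
  HasCompactSupport.intro (isCompact_closedBall u r) fun _ hx =>
    tent_eq_zero hr (le_of_lt (not_le.1 fun h => hx (mem_closedBall.2 h)))

/-- **A countable separating family of test functions.** On a nonempty proper metric space there is a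
sequence `g n` of continuous, compactly supported, nonnegative functions whose linear statistics separate
locally finite configurations: `∑_{p ∈ ω} g n p = ∑_{p ∈ ω'} g n p` for all `n` forces `ω = ω'` (the tents of
radii `1/(m+1)` about a dense sequence: a point `p ∈ ω ∖ ω'` is isolated in `ω ∪ ω'`, and a small tent about a
centre near `p` sees `p` in `ω` and nothing in `ω'`).
[cite: Kallenberg2002, Lemma 16.15, Thm. 16.16 and Thm. A2.3 (ii)] -/
theorem exists_separating_family [ProperSpace X] [Nonempty X] :
    ∃ g : ℕ → X → ℝ, (∀ n, Continuous (g n)) ∧ (∀ n, HasCompactSupport (g n)) ∧ (∀ n x, 0 ≤ g n x) ∧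
      ∀ ω ω' : PointConfig X, (∀ n, ω.sumFn (g n) = ω'.sumFn (g n)) → ω = ω' := by
  obtain ⟨u, hu⟩ := TopologicalSpace.exists_dense_seq X
  refine ⟨fun n x => max 0 (1 - dist x (u n.unpair.1) / (1 / ((n.unpair.2 : ℝ) + 1))),
    fun n => continuous_tent _ _, fun n => hasCompactSupport_tent _ Nat.one_div_pos_of_nat,
    fun n x => le_max_left _ _, ?_⟩
  suffices key : ∀ ω ω' : PointConfig X,
      (∀ n : ℕ, ω.sumFn (fun x => max 0 (1 - dist x (u n.unpair.1) / (1 / ((n.unpair.2 : ℝ) + 1)))) =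
        ω'.sumFn (fun x => max 0 (1 - dist x (u n.unpair.1) / (1 / ((n.unpair.2 : ℝ) + 1))))) →
      ∀ p ∈ ω, p ∈ ω' from
    fun ω ω' h => PointConfig.ext fun p => ⟨key ω ω' h p, key ω' ω (fun n => (h n).symm) p⟩
  intro ω ω' h p hp
  by_contra hp'
  -- `p` is isolated in `ω ∪ ω'`
  have hfin : (((ω : Set X) ∪ (ω' : Set X)) ∩ closedBall p 1).Finite := by
    rw [union_inter_distrib_right]
    exact (ω.finite_inter_isCompact _ (isCompact_closedBall p 1)).union
      (ω'.finite_inter_isCompact _ (isCompact_closedBall p 1))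
  set A : Set X := (((ω : Set X) ∪ (ω' : Set X)) ∩ closedBall p 1) \ {p} with hA
  have hAc : IsClosed A := (hfin.subset sdiff_subset).isClosed
  have hpA : p ∉ A := fun h => h.2 rfl
  obtain ⟨ε, hε, hεA⟩ := Metric.isOpen_iff.1 hAc.isOpen_compl p hpA
  have hiso : ∀ x ∈ (ω : Set X) ∪ (ω' : Set X), dist x p < min ε 1 → x = p := by
    intro x hx hxp
    by_contra hne
    have hxA : x ∈ A := ⟨⟨hx, mem_closedBall.2 (hxp.le.trans (min_le_right _ _))⟩, hne⟩
    exact hεA (mem_ball.2 (hxp.trans_le (min_le_left _ _))) hxA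
  -- a probe tent isolating `p`
  have hε1 : 0 < min ε 1 := lt_min hε one_pos
  obtain ⟨m, hm⟩ := exists_nat_one_div_lt (half_pos hε1)
  set r : ℝ := 1 / ((m : ℝ) + 1) with hr_def
  have hr : 0 < r := Nat.one_div_pos_of_nat
  obtain ⟨i, hi⟩ := hu.exists_dist_lt p hr
  have hn := h (Nat.pair i m)
  simp only [Nat.unpair_pair] at hn
  have hball : ∀ x, x ∈ (support fun x => max 0 (1 - dist x (u i) / r)) → dist x p < min ε 1 := by
    intro x hx
    have h1 : dist x (u i) < r := support_tent_subset hr hx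
    calc dist x p ≤ dist x (u i) + dist p (u i) := dist_triangle_right _ _ _
      _ < r + r := add_lt_add h1 hi
      _ ≤ min ε 1 := by linarith
  have h1 : ω'.sumFn (fun x => max 0 (1 - dist x (u i) / r)) = 0 := by
    rw [PointConfig.sumFn_def]
    refine finsum_mem_of_eqOn_zero fun x hx => ?_
    by_contra hne
    have hxp := hiso x (Or.inr hx) (hball x hne)
    rw [hxp] at hx
    exact hp' hx
  have h2 : ω.sumFn (fun x => max 0 (1 - dist x (u i) / r)) = max 0 (1 - dist p (u i) / r) := by
    rw [PointConfig.sumFn_def, finsum_mem_inter_support_eq _ _ {p}, finsum_mem_singleton]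
    ext x
    constructor
    · rintro ⟨hx, hxs⟩
      exact ⟨hiso x (Or.inl hx) (hball x hxs), hxs⟩
    · rintro ⟨rfl, hxs⟩
      exact ⟨hp, hxs⟩
  have h3 : 0 < max 0 (1 - dist p (u i) / r) := tent_pos hr hi
  rw [h1, h2] at hn
  exact absurd hn h3.ne'

end Tent

/-! ## Exponential statistics of a family of test functions -/

section ExpStat

variable {X : Type*} [MetricSpace X] {g : ℕ → X → ℝ}

/-- Exponential statistics `exp (-∑_{p ∈ ω} g n p)` of nonnegative test functions lie in `[0, 1]`.
[cite: Kallenberg2002, Lemma 16.15, Thm. 16.16 and Thm. A2.3 (ii)] -/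
theorem expStat_mem_Icc (hg0 : ∀ n x, 0 ≤ g n x) (ω : PointConfig X) (n : ℕ) :
    Real.exp (-(ω.sumFn (g n))) ∈ Icc (0 : ℝ) 1 :=
  ⟨(Real.exp_pos _).le, Real.exp_le_one_iff.2 (neg_nonpos.2 (ω.sumFn_nonneg (hg0 n)))⟩

/-- Exponential statistics of `C_c` test functions are vaguely continuous, jointly as a map into the
product `ℕ → ℝ`. [cite: Kallenberg2002, Lemma 16.15, Thm. 16.16 and Thm. A2.3 (ii)] -/
theorem continuous_expStat (hgc : ∀ n, Continuous (g n)) (hgs : ∀ n, HasCompactSupport (g n)) :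
    Continuous fun (ω : PointConfig X) (n : ℕ) => Real.exp (-(ω.sumFn (g n))) :=
  continuous_pi fun n => Real.continuous_exp.comp (PointConfig.continuous_sumFn' (hgc n) (hgs n)).neg

/-- Exponential statistics of a separating family are injective.
[cite: Kallenberg2002, Lemma 16.15, Thm. 16.16 and Thm. A2.3 (ii)] -/
theorem injective_expStat
    (hsepg : ∀ ω ω' : PointConfig X, (∀ n, ω.sumFn (g n) = ω'.sumFn (g n)) → ω = ω') :
    Injective fun (ω : PointConfig X) (n : ℕ) => Real.exp (-(ω.sumFn (g n))) :=
  fun ω ω' h => hsepg ω ω' fun n => neg_injective (Real.exp_injective (congr_fun h n))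

variable [ProperSpace X]

/-- Exponential statistics of `C_c⁺` test functions are measurable for the count σ-algebra.
[cite: Kallenberg2002, Lemma 16.15, Thm. 16.16 and Thm. A2.3 (ii)] -/
theorem measurable_expStat [MeasurableSpace X] [BorelSpace X] (hgc : ∀ n, Continuous (g n))
    (hgs : ∀ n, HasCompactSupport (g n)) (hg0 : ∀ n x, 0 ≤ g n x) :
    Measurable fun (ω : PointConfig X) (n : ℕ) => Real.exp (-(ω.sumFn (g n))) :=
  measurable_pi_lambda _ fun n => measurable_exp_neg_finsum (hgc n).measurable (hgs n) (hg0 n)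

/-- **On uniformly separated configurations, convergence of the exponential statistics of a separating
`C_c` family is vague convergence** (every subsequence has, by `stub_vagueSeqCompactOfSeparated`, a vaguely
convergent subsequence, whose limit has the same statistics as `ν`, hence is `ν`).
[cite: Kallenberg2002, Lemma 16.15, Thm. 16.16 and Thm. A2.3 (ii)] -/
theorem tendsto_of_tendsto_expStat (hgc : ∀ n, Continuous (g n)) (hgs : ∀ n, HasCompactSupport (g n))
    (hsepg : ∀ ω ω' : PointConfig X, (∀ n, ω.sumFn (g n) = ω'.sumFn (g n)) → ω = ω')
    {δ : ℝ} (hδ : 0 < δ) {ω : ℕ → PointConfig X}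
    (hsep : ∀ k, ∀ p ∈ ω k, ∀ q ∈ ω k, p ≠ q → δ ≤ dist p q) {ν : PointConfig X}
    (h : Tendsto (fun k (n : ℕ) => Real.exp (-((ω k).sumFn (g n)))) atTop
      (𝓝 fun n => Real.exp (-(ν.sumFn (g n))))) :
    Tendsto ω atTop (𝓝 ν) := by
  refine tendsto_of_subseq_tendsto fun ns hns => ?_
  obtain ⟨φ, ν', hφ, -, -, hlim⟩ :=
    stub_vagueSeqCompactOfSeparated hδ (fun k => ω (ns k)) fun k => hsep (ns k)
  refine ⟨φ, ?_⟩
  have h1 : Tendsto (fun k (n : ℕ) => Real.exp (-((ω (ns (φ k))).sumFn (g n)))) atTop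
      (𝓝 fun n => Real.exp (-(ν'.sumFn (g n)))) :=
    ((continuous_expStat hgc hgs).tendsto ν').comp hlim
  have h2 : Tendsto (fun k (n : ℕ) => Real.exp (-((ω (ns (φ k))).sumFn (g n)))) atTop
      (𝓝 fun n => Real.exp (-(ν.sumFn (g n)))) :=
    (h.comp hns).comp hφ.tendsto_atTop
  have heq : ν' = ν := injective_expStat hsepg (tendsto_nhds_unique h1 h2)
  rw [← heq]
  exact hlim

end ExpStat

/-! ## Hard-core configurations of `ℝᵈ × ℝᵈ` -/

section HardCore

variable {d : Type*} [Fintype d]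

/-- A `δ`-hard-core configuration is `δ`-separated in phase space (the product norm dominates the norm
of the position component). [cite: Kallenberg2002, Lemma 16.15, Thm. 16.16 and Thm. A2.3 (ii)] -/
theorem le_dist_of_isHardCore {δ : ℝ} {ω : PointConfig (EuclideanSpace ℝ d × EuclideanSpace ℝ d)}
    (h : IsHardCore δ ω) : ∀ p ∈ ω, ∀ q ∈ ω, p ≠ q → δ ≤ dist p q := fun p hp q hq hpq =>
  (h p hp q hq hpq).trans (by rw [dist_eq_norm]; exact norm_fst_le (p - q))

/-- **Vague limits of hard-core configurations are hard core**: if every point of `ν` is, for every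
`ε > 0`, eventually `ε`-close to a point of the `δ`-hard-core configurations `ω k`, then `ν` is `δ`-hard
core (two distinct points of `ν` are approached by two distinct particles of one `ω k`).
[cite: Kallenberg2002, Lemma 16.15, Thm. 16.16 and Thm. A2.3 (ii)] -/
theorem isHardCore_of_approached {δ : ℝ}
    {ω : ℕ → PointConfig (EuclideanSpace ℝ d × EuclideanSpace ℝ d)} (hω : ∀ k, IsHardCore δ (ω k))
    {ν : PointConfig (EuclideanSpace ℝ d × EuclideanSpace ℝ d)}
    (hν : ∀ p ∈ ν, ∀ ε : ℝ, 0 < ε → ∀ᶠ k in atTop, ∃ q ∈ ω k, dist q p < ε) :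
    IsHardCore δ ν := by
  intro p hp q hq hpq
  refine le_of_forall_pos_lt_add fun η hη => ?_
  have hpq0 : 0 < dist p q := dist_pos.2 hpq
  set ε : ℝ := min (η / 2) (dist p q / 2) with hε_def
  have hε : 0 < ε := lt_min (half_pos hη) (half_pos hpq0)
  have hεη : ε ≤ η / 2 := min_le_left _ _
  have hεpq : ε ≤ dist p q / 2 := min_le_right _ _
  obtain ⟨k, ⟨a, ha, hap⟩, ⟨b, hb, hbq⟩⟩ := ((hν p hp ε hε).and (hν q hq ε hε)).exists
  have hab : a ≠ b := by
    rintro rfl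
    have : dist p q ≤ dist a p + dist a q := dist_triangle_left _ _ _
    linarith
  have h1 := hω k a ha b hb hab
  have hap' : ‖a.1 - p.1‖ < ε :=
    lt_of_le_of_lt ((norm_fst_le (a - p)).trans_eq (dist_eq_norm a p).symm) hap
  have hbq' : ‖b.1 - q.1‖ < ε :=
    lt_of_le_of_lt ((norm_fst_le (b - q)).trans_eq (dist_eq_norm b q).symm) hbq
  have h2 : ‖a.1 - b.1‖ ≤ ‖a.1 - p.1‖ + ‖p.1 - q.1‖ + ‖b.1 - q.1‖ :=
    calc ‖a.1 - b.1‖ = ‖(a.1 - p.1) + (p.1 - q.1) - (b.1 - q.1)‖ := by congr 1; abel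
      _ ≤ ‖a.1 - p.1‖ + ‖p.1 - q.1‖ + ‖b.1 - q.1‖ :=
          (norm_sub_le _ _).trans (add_le_add (norm_add_le _ _) le_rfl)
  linarith

variable {g : ℕ → EuclideanSpace ℝ d × EuclideanSpace ℝ d → ℝ}

/-- **The image of the hard-core configurations under the exponential statistics of a `C_c` family is
closed** in the cube (a limit of `F ω_n`, `ω_n` hard core, is `F ν` for a vague subsequential limit `ν`,
which is hard core). [cite: Kallenberg2002, Lemma 16.15, Thm. 16.16 and Thm. A2.3 (ii)] -/
theorem isClosed_image_expStat (hgc : ∀ n, Continuous (g n)) (hgs : ∀ n, HasCompactSupport (g n))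
    {δ : ℝ} (hδ : 0 < δ) :
    IsClosed ((fun (ω : PointConfig (EuclideanSpace ℝ d × EuclideanSpace ℝ d)) (n : ℕ) =>
      Real.exp (-(ω.sumFn (g n)))) '' {ω | IsHardCore δ ω}) := by
  refine IsSeqClosed.isClosed fun z y hz hzy => ?_
  choose ω hω hωz using hz
  obtain ⟨φ, ν, hφ, -, happ, hlim⟩ :=
    stub_vagueSeqCompactOfSeparated hδ ω fun k => le_dist_of_isHardCore (hω k)
  have hν : IsHardCore δ ν := isHardCore_of_approached (fun k => hω (φ k)) happ
  refine ⟨ν, hν, ?_⟩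
  have h1 : Tendsto (fun k (n : ℕ) => Real.exp (-((ω (φ k)).sumFn (g n)))) atTop
      (𝓝 fun n => Real.exp (-(ν.sumFn (g n)))) :=
    ((continuous_expStat hgc hgs).tendsto ν).comp hlim
  have h2 : Tendsto (fun k (n : ℕ) => Real.exp (-((ω (φ k)).sumFn (g n)))) atTop (𝓝 y) := by
    have : (fun k (n : ℕ) => Real.exp (-((ω (φ k)).sumFn (g n)))) = z ∘ φ :=
      funext fun k => hωz (φ k)
    rw [this]
    exact hzy.comp hφ.tendsto_atTop
  exact tendsto_nhds_unique h1 h2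

/-- The image of the hard-core configurations under the exponential statistics of a `C_c⁺` family is
compact (closed in the cube `ℕ → [0, 1]`). [cite: Kallenberg2002, Lemma 16.15, Thm. 16.16 and Thm. A2.3 (ii)] -/
theorem isCompact_image_expStat (hgc : ∀ n, Continuous (g n)) (hgs : ∀ n, HasCompactSupport (g n))
    (hg0 : ∀ n x, 0 ≤ g n x) {δ : ℝ} (hδ : 0 < δ) :
    IsCompact ((fun (ω : PointConfig (EuclideanSpace ℝ d × EuclideanSpace ℝ d)) (n : ℕ) =>
      Real.exp (-(ω.sumFn (g n)))) '' {ω | IsHardCore δ ω}) :=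
  (isCompact_univ_pi fun _ : ℕ => isCompact_Icc).of_isClosed_subset (isClosed_image_expStat hgc hgs hδ)
    (by
      rintro _ ⟨ω, -, rfl⟩
      exact fun n _ => expStat_mem_Icc hg0 ω n)

/-! ## Hard-core laws are vaguely relatively compact -/

/-- **Hard-core laws are vaguely relatively compact** — the body of the named fact `HardCoreLawsVaguelyCompact`
(Kallenberg 2002, Lemma 16.15 + Thm. 16.16 + Thm. A2.3 (ii), specialised to laws of `δ`-hard-core simple
configurations in `ℝᵈ × ℝᵈ`): every sequence of probability laws on `PointConfig (ℝᵈ × ℝᵈ)` that are almost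
surely `δ`-hard core (`δ > 0`) admits a probability law `μ`, almost surely `δ`-hard core, which is a vague
cluster point of the sequence: along a subsequence the Laplace functionals converge to those of `μ` for every
continuous compactly supported `f ≥ 0`. Proof: embed the hard-core configurations by the exponential
statistics `F` of a separating `C_c⁺` family into their compact metrisable image `Z`; `ProbabilityMeasure Z`
is compact (Riesz–Markov, Mathlib) and metrisable (Lévy–Prokhorov), so the pushed laws converge along a
subsequence; pull the limit back by the vaguely continuous, count-measurable inverse `S : Z → K_δ`; the
Laplace integrands `exp (-∑ f)` are bounded continuous on `Z`. Registered stub of line `FirstLemma`.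
[cite: Kallenberg2002, Lemma 16.15, Thm. 16.16 and Thm. A2.3 (ii)] -/
theorem stub_hardCoreLawsVaguelyCompact :
    ∀ (d : Type) [Fintype d] (δ : ℝ), 0 < δ →
      ∀ P : ℕ → MeasureTheory.Measure (Literature.Analysis.FunctionSpaces.PointConfig (EuclideanSpace ℝ d × EuclideanSpace ℝ d)),
        (∀ k, MeasureTheory.IsProbabilityMeasure (P k)) →
        (∀ k, Filter.Eventually (fun ω => Literature.Analysis.FluidPDE.IsHardCore δ ω) (MeasureTheory.ae (P k))) →
        ∃ μ : MeasureTheory.Measure (Literature.Analysis.FunctionSpaces.PointConfig (EuclideanSpace ℝ d × EuclideanSpace ℝ d)),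
          MeasureTheory.IsProbabilityMeasure μ ∧
            Filter.Eventually (fun ω => Literature.Analysis.FluidPDE.IsHardCore δ ω) (MeasureTheory.ae μ) ∧
            Literature.MathematicalPhysics.KineticTheory.PointProcess.IsVagueClusterPoint μ P := by
  intro d _ δ hδ P hP hPhc
  classical
  -- a separating family and its exponential statistics `F`
  obtain ⟨g, hgc, hgs, hg0, hsepg⟩ :=
    exists_separating_family (X := EuclideanSpace ℝ d × EuclideanSpace ℝ d)
  set K : Set (PointConfig (EuclideanSpace ℝ d × EuclideanSpace ℝ d)) := {ω | IsHardCore δ ω} with hK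
  set F : PointConfig (EuclideanSpace ℝ d × EuclideanSpace ℝ d) → ℕ → ℝ :=
    fun ω n => Real.exp (-(ω.sumFn (g n))) with hF
  have hFmeas : Measurable F := measurable_expStat hgc hgs hg0
  have hFinj : Injective F := injective_expStat hsepg
  set Zs : Set (ℕ → ℝ) := F '' K with hZs
  have hZclosed : IsClosed Zs := isClosed_image_expStat hgc hgs hδ
  have hZcomp : IsCompact Zs := isCompact_image_expStat hgc hgs hg0 hδ
  have hKmeas : MeasurableSet K := by
    have hKeq : F ⁻¹' Zs = K := hFinj.preimage_image _
    rw [← hKeq]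
    exact hFmeas hZclosed.measurableSet
  haveI : CompactSpace Zs := isCompact_iff_compactSpace.1 hZcomp
  -- the inverse `S : Z → K`
  set S : Zs → PointConfig (EuclideanSpace ℝ d × EuclideanSpace ℝ d) := fun z => z.2.choose with hS
  have hSK : ∀ z : Zs, IsHardCore δ (S z) := fun z => z.2.choose_spec.1
  have hFS : ∀ z : Zs, F (S z) = z := fun z => z.2.choose_spec.2
  have hSF : ∀ ω (h : F ω ∈ Zs), S ⟨F ω, h⟩ = ω := fun ω h => hFinj (hFS ⟨F ω, h⟩)
  have hScont : Continuous S := by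
    refine continuous_iff_seqContinuous.2 fun z y hzy => ?_
    have h1 : Tendsto (fun k => F (S (z k))) atTop (𝓝 (F (S y))) := by
      have h2 : Tendsto (fun k => ((z k : Zs) : ℕ → ℝ)) atTop (𝓝 (y : ℕ → ℝ)) :=
        (continuous_subtype_val.tendsto y).comp hzy
      rw [show (fun k => F (S (z k))) = fun k => ((z k : Zs) : ℕ → ℝ) from funext fun k => hFS (z k),
        hFS y]
      exact h2
    exact tendsto_of_tendsto_expStat hgc hgs hsepg hδ (fun k => le_dist_of_isHardCore (hSK (z k))) h1
  have hSmeas : Measurable S := stub_measurableOfVagueContinuous hScont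
  -- the projection `F' : PointConfig → Z` (equal to `F` on `K`)
  set z₀ : Zs := ⟨F ∅, ∅, isHardCore_empty δ, rfl⟩ with hz₀
  set F' : PointConfig (EuclideanSpace ℝ d × EuclideanSpace ℝ d) → Zs := fun ω =>
    if h : ω ∈ F ⁻¹' Zs then (⟨F ω, h⟩ : Zs) else z₀ with hF'
  have hF'meas : Measurable F' :=
    Measurable.dite (f := fun x : F ⁻¹' Zs => (⟨F x.1, x.2⟩ : Zs))
      ((hFmeas.comp measurable_subtype_coe).subtype_mk) measurable_const
      (hZclosed.measurableSet.preimage hFmeas)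
  have hF'K : ∀ ω ∈ K, S (F' ω) = ω := by
    intro ω hω
    have h : ω ∈ F ⁻¹' Zs := ⟨ω, hω, rfl⟩
    have : F' ω = ⟨F ω, h⟩ := dif_pos h
    rw [this, hSF ω h]
  -- the pushed laws on the compact metrisable space `Z` and a convergent subsequence
  haveI := hP
  set Pz : ℕ → ProbabilityMeasure Zs := fun k =>
    ⟨(P k).map F', Measure.isProbabilityMeasure_map hF'meas.aemeasurable⟩ with hPz
  obtain ⟨ρ, κ, hκ, hlim⟩ := CompactSpace.tendsto_subseq Pz
  -- the limit law on configurations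
  set μ : Measure (PointConfig (EuclideanSpace ℝ d × EuclideanSpace ℝ d)) :=
    (ρ : Measure Zs).map S with hμ
  haveI : IsProbabilityMeasure μ := Measure.isProbabilityMeasure_map hSmeas.aemeasurable
  refine ⟨μ, inferInstance, ?_, κ, hκ, fun f hf hcs h0 => ?_⟩
  · exact (ae_map_iff hSmeas.aemeasurable hKmeas).2 (ae_of_all _ fun z => hSK z)
  · -- the Laplace integrand as a bounded continuous function on `Z`
    have hGcont : Continuous fun z : Zs => Real.exp (-((S z).sumFn f)) :=
      Real.continuous_exp.comp ((PointConfig.continuous_sumFn' hf hcs).comp hScont).neg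
    set G : Zs →ᵇ ℝ := BoundedContinuousFunction.mkOfCompact ⟨_, hGcont⟩ with hG
    have hGapply : ∀ z, G z = Real.exp (-((S z).sumFn f)) := fun z => rfl
    have hmeasf : Measurable fun ω : PointConfig (EuclideanSpace ℝ d × EuclideanSpace ℝ d) =>
        Real.exp (-(∑ᶠ p ∈ (ω : Set (EuclideanSpace ℝ d × EuclideanSpace ℝ d)), f p)) :=
      measurable_exp_neg_finsum hf.measurable hcs h0
    -- Laplace functionals of the `P k` are expectations of `G` under the pushed laws
    have hPk : ∀ k, laplaceFunctional (P k) f = ∫ z, G z ∂(Pz k : Measure Zs) := by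
      intro k
      have hmap : ((Pz k : ProbabilityMeasure Zs) : Measure Zs) = (P k).map F' := rfl
      rw [hmap, integral_map hF'meas.aemeasurable G.continuous.measurable.aestronglyMeasurable]
      refine integral_congr_ae ?_
      filter_upwards [hPhc k] with ω hω
      rw [hGapply, hF'K ω hω, PointConfig.sumFn_def]
    -- and so is the Laplace functional of `μ`
    have hμf : laplaceFunctional μ f = ∫ z, G z ∂(ρ : Measure Zs) := by
      show ∫ ω, Real.exp (-(∑ᶠ p ∈ (ω : Set (EuclideanSpace ℝ d × EuclideanSpace ℝ d)), f p)) ∂μ = _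
      rw [hμ, integral_map hSmeas.aemeasurable hmeasf.aestronglyMeasurable]
      rfl
    rw [hμf]
    simp only [hPk]
    exact (ProbabilityMeasure.tendsto_iff_forall_integral_tendsto.1 hlim G)

end HardCore

end Literature.MathematicalPhysics.KineticTheory.PointProcess.HardCoreVagueCompactness

end Part3

/-! ## Part 4 — the EXACT discharge `HardCoreLawsVaguelyCompact_holds` -/

namespace Literature.MathematicalPhysics.KineticTheory.PointProcess

/-- **Kallenberg 2002, Lemma 16.15 / Thm. 16.16 / Thm. A2.3 (ii), hard-core simple case — the named fact `HardCoreLawsVaguelyCompact` HOLDS**: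
laws of `δ`-hard-core simple configurations in `ℝᵈ × ℝᵈ` are vaguely sequentially compact, with hard-core probability limits.  EXACT-name
discharge by `HardCoreVagueCompactness.stub_hardCoreLawsVaguelyCompact` (separating tents, the compact statistic `expStat`, Prokhorov on its image);
Literature-side twin of the Summits-side `Summit.AtomisticToContinuum.HydrodynamicLimit.Theorems.KiferCompactification.hardCoreLawsVaguelyCompact_holds`.
[cite: Kallenberg2002, Lemma 16.15, Thm. 16.16 and Thm. A2.3 (ii)] -/
theorem HardCoreLawsVaguelyCompact_holds : HardCoreLawsVaguelyCompact := by
  unfold HardCoreLawsVaguelyCompact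
  exact HardCoreVagueCompactness.stub_hardCoreLawsVaguelyCompact

end Literature.MathematicalPhysics.KineticTheory.PointProcess

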